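/-
Copyright: public-audit package `pub-balaban` (b2b-balaban), seat pv28-g15. Released under Apache 2.0 like Mathlib.
-/
import Literature.MathematicalPhysics.QuantumFieldTheory.Balaban1983to89.T4WilsonDisjointLinks

/-!
# T4 — caveat (FAM) of the disjoint-fibre plug and the COMBINATORIAL CEILING of the disjoint device: the transverse
# parity classes are plaquette-disjoint, inclusion-maximal, of density exactly `1/(2d)`, and NO plaquette-disjoint link
# set has more than a quarter of the links — so complements of forests (gauge-fixed fibres) are never reached

* Value = kernel certificate (finite lattice combinatorics on the tori of the cell: which plaquettes see which links,
  parities modulo `2`, double counting) + exact census numbers; NOT summit progress; NOT continuum; NOT Clay.  0 [cite],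
  0 [model]: everything here is [folklore]; NO printed sentence is asserted and nothing internally minted is cited
  (ABSOLUTE RULE).  Cell row T4-O3.E-iii-b-G7 (BL-window), lineage pv28, record `t4/T4-EST-O3Eiiib-G7.md`; this leaf
  types item (FAM) of GAPS G-pv28g14-2 and quantifies the reach of `T4WilsonDisjointLinks` (p191493).
* THE QUESTION (FAM).  `T4WilsonDisjointLinks.mem_respDom_of_wilson_disjoint` discharges the gnomonic window plug on
  every PLAQUETTE-DISJOINT link set `s` (`PlaqDisjoint s`: no link of `s` is a staple bond of another) with the ONE-LINK
  modulus and the PER-LINK window, but exhibits no such set beyond singletons (its caveat (d)).  How large can `s` be,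
  and can it ever be a fibre a gauge-fixed consumer integrates over?
* THE ANSWER TYPED HERE.
  (1) COUNTING ON THE TORI OF THE CELL (§1): `#PBond = #Site·d` (`card_pbond`), every plaquette has exactly four
      letters (`card_filter_isLetter`), DOUBLE COUNTING `Σ_{b ∈ s} N_b = Σ_p #{b ∈ s : b ∈ ∂p}` (`sum_letterCount_eq`)
      with `N_b = 2(d−1)` (`T4WilsonLinkAffine.letterCount_eq`), hence `4·#Plaq = #PBond·2(d−1)` and
      `2·#Plaq = #Site·d·(d−1)` (`four_mul_card_plaq`, `two_mul_card_plaq`).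
  (2) THE CEILING (§2): a plaquette-disjoint `s` meets every plaquette in at most one letter
      (`card_filter_isLetter_le_one`), so `#s·2(d−1) ≤ #Plaq` (`card_mul_le_card_plaq`) and, for `d ≥ 2`,
      **`4·#s ≤ #PBond`** (`four_mul_card_le_card_pbond`): the disjoint device never covers more than a QUARTER of the
      links.  Consequences: the complement of ANY link set with fewer links than sites — every forest, in particular
      every axial / tree gauge-fixing set — is NOT plaquette-disjoint (`not_plaqDisjoint_sdiff_of_card_lt`, `d ≥ 2`),
      and a link set containing ALL links of one direction is not plaquette-disjoint (`not_plaqDisjoint_of_dir_subset`: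
      `⟨x, μ₀⟩`, `⟨x + e_ν, μ₀⟩` are letters 1, 3 of `(x; μ₀, ν)`).
  (3) THE FAMILY (§3–§4): every torus of the cell has an EVEN number `2·L^{m+K−j}` of sites per direction
      (`two_dvd_sitesPerDir`), so the TRANSVERSE PARITY `tparity μ₀ x = Σ_{ν ≠ μ₀} (x_ν mod 2) ∈ ZMod 2` is well defined
      (`parityHom = ZMod.castHom`), FLIPS under a unit step in any direction `ν ≠ μ₀` (`tparity_shift_of_ne`) and is blind
      to steps along `μ₀` (`tparity_shift_self`).  Two same-direction letters of one plaquette differ by exactly one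
      transverse unit step (`exists_shift_of_isStaple`), hence have OPPOSITE link parities
      (`linkParity_ne_of_isStaple`).  THE CLASSES `dirClass μ₀ c = {b : b.dir = μ₀, linkParity b = c}`,
      `(μ₀, c) ∈ Fin d × ZMod 2`, are therefore PLAQUETTE-DISJOINT (**`plaqDisjoint_dirClass`**, every `d ≥ 1`), the
      `2d` of them PARTITION the bond set (`mem_dirClass_linkLabel`, `disjoint_dirClass`, `biUnion_dirClass`,
      `sum_card_dirClass`), and for `d ≥ 2` each has EXACTLY HALF OF THE SITES' WORTH of links
      (**`two_mul_card_dirClass`**: the transverse shift `transShift ν` is a parity-swapping injection of the bonds) —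
      density `1/(2d)` of all links, star-free (`not_containsStar_dirClass`), non-empty (`dirClass_nonempty`), and of
      MAXIMUM SIZE when `d = 2` (`four_mul_card_dirClass`: `4·# = #PBond`, equality in the ceiling).
  (4) MAXIMALITY (§5, `d ≥ 2`): every link outside `dirClass μ₀ c` is a staple bond of a link inside it
      (`exists_isStaple_mem_dirClass`), so each parity class is an INCLUSION-MAXIMAL plaquette-disjoint set
      (**`dirClass_maximal`**): the disjoint plug p191493 applies to it verbatim (`hdis := plaqDisjoint_dirClass μ₀ c`)
      and to nothing larger containing it.
* THE LOCATED VERDICT FOR THE LINEAGE.  The disjoint device is NOT vacuous at macroscopic size (half the links of a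
  direction at once, uniformly in the volume and in `j`), but it provably stops at a quarter of the links and never
  reaches a fibre whose fixed complement is a forest: for gauge-fixed integration the shared-plaquette case (N1-gen) of
  GAPS G-pv28g14-2 is UNAVOIDABLE — now with exact numbers, not adjectives.

## Honest caveats

* WHAT THIS DOES NOT DO.  (a) Nothing analytic: no Hessian, no integral, no new estimate — the plug itself is
  `T4WilsonDisjointLinks.mem_respDom_of_wilson_disjoint`, used by name only through `PlaqDisjoint`.  (b) The ceiling
  `4·#s ≤ #PBond` is attained for `d = 2`; whether it is attained for `d ≥ 3` (the parity classes give `2/d` of it) is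
  not decided here and not needed.  (c) (N1-gen) (shared plaquettes), (SIZE-Σ), (GF), (JAC), (USE-a/c), (RANK), (INS),
  (k ≥ 1), (EXP) of GAPS G-pv28g14-2 are untouched.  (d) "Forest" is used only through the numerical hypothesis
  `#T < #Site` (`not_plaqDisjoint_sdiff_of_card_lt`); no tree structure of the tree is imported or re-proved.
  Nothing printed is read or asserted.
-/


noncomputable section

namespace Literature.MathematicalPhysics.QuantumFieldTheory.Balaban1983to89.T4PlaqDisjointFamilies

open T4WilsonLinkAffine
open T4WilsonSmallFieldNumerics (IsStaple)
open T4WilsonGaugeFlatDirection (ContainsStar)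
open T4WilsonDisjointLinks (PlaqDisjoint not_containsStar_of_plaqDisjoint)

variable {P : Params} {j : ℕ}

/-! ## §1  Counting on the tori of the cell -/

/-- A positively oriented bond is a pair (initial site, direction). [folklore] -/
def pbondEquiv (P : Params) (j : ℕ) : PBond P j ≃ Site P j × Fin P.d :=
  ⟨fun b => (b.src, b.dir), fun q => ⟨q.1, q.2⟩, fun _ => rfl, fun _ => rfl⟩

/-- **`#PBond = #Site · d`.** [folklore] -/
theorem card_pbond (P : Params) (j : ℕ) : Fintype.card (PBond P j) = Fintype.card (Site P j) * P.d := by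
  rw [Fintype.card_congr (pbondEquiv P j), Fintype.card_prod, Fintype.card_fin]

/-- There is at least one site, hence `#PBond ≥ d`. [folklore] -/
theorem card_site_pos (P : Params) (j : ℕ) : 0 < Fintype.card (Site P j) := Fintype.card_pos

/-- Two distinct letters of one plaquette are staple bonds of each other (the definition of `IsStaple`). [folklore] -/
theorem isStaple_of_isLetter {b b' : PBond P j} (p : Plaq P j) (hb : IsLetter b p) (hb' : IsLetter b' p)
    (hne : b' ≠ b) : IsStaple b b' :=
  ⟨hne, p, hb, hb'⟩

variable [DecidableEq (PBond P j)]

/-- The letters of `∂p` as a finite set: `{bond₁ p, bond₂ p, bond₃ p, bond₄ p}`. [folklore] -/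
theorem filter_isLetter_eq (p : Plaq P j) :
    (Finset.univ.filter fun b : PBond P j => IsLetter b p) = {bond₁ p, bond₂ p, bond₃ p, bond₄ p} := by
  ext b
  simp [IsLetter]

/-- **Every plaquette has exactly four letters** (`T4WilsonLinkAffine.letters_pairwise_ne`). [folklore] -/
theorem card_filter_isLetter (p : Plaq P j) : (Finset.univ.filter fun b : PBond P j => IsLetter b p).card = 4 := by
  obtain ⟨h12, h13, h14, h23, h24, h34⟩ := letters_pairwise_ne p
  rw [filter_isLetter_eq, Finset.card_insert_of_notMem (by simp [h12, h13, h14]),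
    Finset.card_insert_of_notMem (by simp [h23, h24]), Finset.card_pair h34]

/-- **DOUBLE COUNTING of the incidences `b ∈ ∂p`**: `Σ_{b ∈ s} N_b = Σ_p #{b ∈ s : b ∈ ∂p}`. [folklore] -/
theorem sum_letterCount_eq (s : Finset (PBond P j)) :
    ∑ b ∈ s, letterCount b = ∑ p : Plaq P j, (s.filter fun b => IsLetter b p).card := by
  simp only [letterCount, Finset.card_filter]
  exact Finset.sum_comm

/-- **`4 · #Plaq = #PBond · 2(d − 1)`** (`N_b = 2(d − 1)`, `T4WilsonLinkAffine.letterCount_eq`, summed over all bonds,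
against four letters per plaquette). [folklore] -/
theorem four_mul_card_plaq (P : Params) (j : ℕ) [DecidableEq (PBond P j)] :
    4 * Fintype.card (Plaq P j) = Fintype.card (PBond P j) * (2 * (P.d - 1)) := by
  have h1 : ∑ b : PBond P j, letterCount b = Fintype.card (PBond P j) * (2 * (P.d - 1)) := by
    rw [Finset.sum_const_nat fun b _ => letterCount_eq b, Finset.card_univ]
  have h2 : ∑ b : PBond P j, letterCount b = 4 * Fintype.card (Plaq P j) := by
    rw [sum_letterCount_eq, Finset.sum_const_nat fun p _ => card_filter_isLetter p, Finset.card_univ, mul_comm]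
  rw [← h2, h1]

/-- **`2 · #Plaq = #Site · d · (d − 1)`**: the number of plaquettes of a torus of the cell. [folklore] -/
theorem two_mul_card_plaq (P : Params) (j : ℕ) [DecidableEq (PBond P j)] :
    2 * Fintype.card (Plaq P j) = Fintype.card (Site P j) * P.d * (P.d - 1) := by
  have h := four_mul_card_plaq P j
  rw [card_pbond] at h
  refine Nat.eq_of_mul_eq_mul_left zero_lt_two ?_
  calc 2 * (2 * Fintype.card (Plaq P j)) = 4 * Fintype.card (Plaq P j) := by ring
    _ = Fintype.card (Site P j) * P.d * (2 * (P.d - 1)) := h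
    _ = 2 * (Fintype.card (Site P j) * P.d * (P.d - 1)) := by ring

/-! ## §2  The ceiling: a plaquette-disjoint link set has at most a quarter of the links -/

/-- A plaquette-disjoint link set meets every plaquette in AT MOST ONE letter. [folklore] -/
theorem card_filter_isLetter_le_one {s : Finset (PBond P j)} (hs : PlaqDisjoint s) (p : Plaq P j) :
    (s.filter fun b => IsLetter b p).card ≤ 1 := by
  refine Finset.card_le_one.2 fun b hb b' hb' => ?_
  rw [Finset.mem_filter] at hb hb'
  by_contra hne
  exact hs b hb.1 b' (isStaple_of_isLetter p hb.2 hb'.2 (fun h => hne h.symm)) hb'.1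

/-- **THE CEILING, plaquette form**: `#s · 2(d − 1) ≤ #Plaq` for every plaquette-disjoint `s` (each of its links lies on
`2(d − 1)` plaquettes, each plaquette carries at most one of its links). [folklore] -/
theorem card_mul_le_card_plaq {s : Finset (PBond P j)} (hs : PlaqDisjoint s) :
    s.card * (2 * (P.d - 1)) ≤ Fintype.card (Plaq P j) := by
  calc s.card * (2 * (P.d - 1)) = ∑ b ∈ s, letterCount b := (Finset.sum_const_nat fun b _ => letterCount_eq b).symm
    _ = ∑ p : Plaq P j, (s.filter fun b => IsLetter b p).card := sum_letterCount_eq s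
    _ ≤ ∑ _p : Plaq P j, 1 := Finset.sum_le_sum fun p _ => card_filter_isLetter_le_one hs p
    _ = Fintype.card (Plaq P j) := by simp

/-- **THE CEILING, link form** (`d ≥ 2`): `4 · #s ≤ #PBond` — a plaquette-disjoint link set never contains more than a
QUARTER of the links. [folklore] -/
theorem four_mul_card_le_card_pbond (h2 : 2 ≤ P.d) {s : Finset (PBond P j)} (hs : PlaqDisjoint s) :
    4 * s.card ≤ Fintype.card (PBond P j) := by
  have hk : 0 < 2 * (P.d - 1) := by omega
  refine Nat.le_of_mul_le_mul_right ?_ hk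
  calc 4 * s.card * (2 * (P.d - 1)) = 4 * (s.card * (2 * (P.d - 1))) := by ring
    _ ≤ 4 * Fintype.card (Plaq P j) := Nat.mul_le_mul_left 4 (card_mul_le_card_plaq hs)
    _ = Fintype.card (PBond P j) * (2 * (P.d - 1)) := four_mul_card_plaq P j

/-- **COMPLEMENTS OF FORESTS ARE NEVER PLAQUETTE-DISJOINT** (`d ≥ 2`): if `T` has fewer links than there are sites —
every forest of the site graph does, in particular every axial / tree gauge-fixing set — then the complementary fibre
`univ \ T` is not plaquette-disjoint (it has more than `(d − 1)·#Site ≥ #PBond/2 > #PBond/4` links). [folklore] -/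
theorem not_plaqDisjoint_sdiff_of_card_lt (h2 : 2 ≤ P.d) {T : Finset (PBond P j)}
    (hT : T.card < Fintype.card (Site P j)) : ¬ PlaqDisjoint (Finset.univ \ T) := by
  intro hs
  have h := four_mul_card_le_card_pbond h2 hs
  rw [Finset.card_univ_sdiff] at h
  have hN : Fintype.card (Site P j) * 2 ≤ Fintype.card (PBond P j) := by
    rw [card_pbond]
    exact Nat.mul_le_mul_left _ h2
  omega

omit [DecidableEq (PBond P j)] in
/-- **A WHOLE DIRECTION IS NEVER PLAQUETTE-DISJOINT** (`d ≥ 2`): a link set containing every link of some direction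
`μ₀` contains the two letters `⟨x, μ₀⟩`, `⟨x + e_ν, μ₀⟩` of a plaquette `(x; μ₀, ν)` resp. `(x; ν, μ₀)`. [folklore] -/
theorem not_plaqDisjoint_of_dir_subset (h2 : 2 ≤ P.d) (μ₀ : Fin P.d) {s : Finset (PBond P j)}
    (h : ∀ x : Site P j, (⟨x, μ₀⟩ : PBond P j) ∈ s) : ¬ PlaqDisjoint s := by
  haveI : Nontrivial (Fin P.d) := Fin.nontrivial_iff_two_le.2 h2
  obtain ⟨ν, hν⟩ := exists_ne μ₀
  intro hs
  set x₀ : Site P j := default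
  rcases lt_or_gt_of_ne hν with hlt | hgt
  · -- `ν < μ₀`: the plaquette `(x₀; ν, μ₀)` has letters 4 = `⟨x₀, μ₀⟩` and 2 = `⟨x₀ + e_ν, μ₀⟩`
    let p : Plaq P j := ⟨x₀, ν, μ₀, hlt⟩
    exact hs _ (h x₀) _ (isStaple_of_isLetter p (b := bond₄ p) (b' := bond₂ p)
      (Or.inr (Or.inr (Or.inr rfl))) (Or.inr (Or.inl rfl)) (bond₂_ne_bond₄ p)) (h _)
  · -- `μ₀ < ν`: the plaquette `(x₀; μ₀, ν)` has letters 1 = `⟨x₀, μ₀⟩` and 3 = `⟨x₀ + e_ν, μ₀⟩`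
    let p : Plaq P j := ⟨x₀, μ₀, ν, hgt⟩
    exact hs _ (h x₀) _ (isStaple_of_isLetter p (b := bond₁ p) (b' := bond₃ p)
      (Or.inl rfl) (Or.inr (Or.inr (Or.inl rfl))) (bond₁_ne_bond₃ p).symm) (h _)

/-! ## §3  The transverse parity on the (even) tori of the cell -/

omit [DecidableEq (PBond P j)] in
/-- Every torus of the cell has an EVEN number `2·L^{m+K−j}` of sites per direction (`Params.sitesPerDir`). [folklore] -/
theorem two_dvd_sitesPerDir (P : Params) (j : ℕ) : 2 ∣ P.sitesPerDir j := by
  unfold Params.sitesPerDir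
  exact dvd_mul_right 2 _

/-- The coordinate parity `ZMod (2·L^{m+K−j}) →+* ZMod 2` (well defined because the modulus is even). [folklore] -/
def parityHom (P : Params) (j : ℕ) : ZMod (P.sitesPerDir j) →+* ZMod 2 :=
  ZMod.castHom (two_dvd_sitesPerDir P j) (ZMod 2)

/-- **THE TRANSVERSE PARITY** of a site relative to the direction `μ₀`: `Σ_{ν ≠ μ₀} (x_ν mod 2) ∈ ZMod 2`. [folklore] -/
def tparity (μ₀ : Fin P.d) (x : Site P j) : ZMod 2 := ∑ ν ∈ Finset.univ.erase μ₀, parityHom P j (x ν)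

omit [DecidableEq (PBond P j)] in
/-- **A unit step in a transverse direction FLIPS the transverse parity.** [folklore] -/
theorem tparity_shift_of_ne {μ₀ ν : Fin P.d} (h : ν ≠ μ₀) (x : Site P j) :
    tparity μ₀ (x.shift ν) = tparity μ₀ x + 1 := by
  unfold tparity Site.shift
  have hν : ν ∈ Finset.univ.erase μ₀ := Finset.mem_erase.2 ⟨h, Finset.mem_univ _⟩
  have e1 : (fun κ => parityHom P j (Function.update x ν (x ν + 1) κ))
      = Function.update (fun κ => parityHom P j (x κ)) ν (parityHom P j (x ν + 1)) := by
    funext κ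
    by_cases hκ : κ = ν
    · subst hκ; simp
    · simp [Function.update_of_ne hκ]
  rw [e1, Finset.sum_update_of_mem hν, Finset.sum_eq_add_sum_sdiff_singleton_of_mem hν, map_add, map_one]
  ring

omit [DecidableEq (PBond P j)] in
/-- A unit step ALONG `μ₀` does not change the transverse parity. [folklore] -/
theorem tparity_shift_self (μ₀ : Fin P.d) (x : Site P j) : tparity μ₀ (x.shift μ₀) = tparity μ₀ x := by
  unfold tparity Site.shift
  refine Finset.sum_congr rfl fun κ hκ => ?_
  rw [Function.update_of_ne (Finset.mem_erase.1 hκ).1]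

/-- **THE LINK PARITY**: the transverse parity of the initial site relative to the link's own direction. [folklore] -/
def linkParity (b : PBond P j) : ZMod 2 := tparity b.dir b.src

omit [DecidableEq (PBond P j)] in
/-- **TWO SAME-DIRECTION LETTERS OF ONE PLAQUETTE DIFFER BY EXACTLY ONE TRANSVERSE UNIT STEP**: for `p = (x; μ, ν)`,
`μ < ν`, the letters of direction `μ` are `⟨x, μ⟩`, `⟨x + e_ν, μ⟩` and those of direction `ν` are `⟨x + e_μ, ν⟩`,
`⟨x, ν⟩` (the sixteen letter cases of `IsStaple`). [folklore] -/
theorem exists_shift_of_isStaple {b b' : PBond P j} (hst : IsStaple b b') (hdir : b'.dir = b.dir) :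
    ∃ ν : Fin P.d, ν ≠ b.dir ∧ (b'.src = b.src.shift ν ∨ b.src = b'.src.shift ν) := by
  obtain ⟨hne, p, hb, hb'⟩ := hst
  have hμν : p.μ ≠ p.ν := ne_of_lt p.hμν
  rcases hb with rfl | rfl | rfl | rfl <;> rcases hb' with rfl | rfl | rfl | rfl
  all_goals first
    | exact absurd rfl hne
    | exact ⟨p.ν, hμν.symm, Or.inl rfl⟩
    | exact ⟨p.ν, hμν.symm, Or.inr rfl⟩
    | exact ⟨p.μ, hμν, Or.inl rfl⟩
    | exact ⟨p.μ, hμν, Or.inr rfl⟩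
    | exact absurd hdir hμν
    | exact absurd hdir hμν.symm

omit [DecidableEq (PBond P j)] in
/-- **HENCE SAME-DIRECTION STAPLE BONDS HAVE OPPOSITE LINK PARITIES.** [folklore] -/
theorem linkParity_ne_of_isStaple {b b' : PBond P j} (hst : IsStaple b b') (hdir : b'.dir = b.dir) :
    linkParity b' ≠ linkParity b := by
  have h1 : ∀ c : ZMod 2, c + 1 ≠ c := by decide
  unfold linkParity
  rw [hdir]
  obtain ⟨ν, hν, h | h⟩ := exists_shift_of_isStaple ⟨hst.1, hst.2⟩ hdir
  · rw [h, tparity_shift_of_ne hν]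
    exact h1 _
  · rw [h, tparity_shift_of_ne hν]
    exact (h1 _).symm

/-! ## §4  The parity classes: plaquette-disjoint, a partition of the bonds into `2d` classes of `#Site/2` links -/

/-- The class label of a link: (direction, link parity). [folklore] -/
def linkLabel (b : PBond P j) : Fin P.d × ZMod 2 := (b.dir, linkParity b)

/-- **THE PARITY CLASS `(μ₀, c)`**: the links of direction `μ₀` whose initial site has transverse parity `c`.
[folklore] -/
def dirClass (μ₀ : Fin P.d) (c : ZMod 2) : Finset (PBond P j) := Finset.univ.filter fun b => linkLabel b = (μ₀, c)

omit [DecidableEq (PBond P j)] in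
/-- Membership in a parity class. [folklore] -/
theorem mem_dirClass {μ₀ : Fin P.d} {c : ZMod 2} {b : PBond P j} :
    b ∈ dirClass μ₀ c ↔ b.dir = μ₀ ∧ linkParity b = c := by
  simp [dirClass, linkLabel, Prod.ext_iff]

omit [DecidableEq (PBond P j)] in
/-- **EVERY PARITY CLASS IS PLAQUETTE-DISJOINT** (on every torus of the cell, every `d ≥ 1`): two of its links in one
plaquette would be same-direction staple bonds of equal parity (`linkParity_ne_of_isStaple`). [folklore] -/
theorem plaqDisjoint_dirClass (μ₀ : Fin P.d) (c : ZMod 2) : PlaqDisjoint (dirClass μ₀ c : Finset (PBond P j)) := by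
  intro b hb b' hst hb'
  rw [mem_dirClass] at hb hb'
  exact linkParity_ne_of_isStaple hst (hb'.1.trans hb.1.symm) (hb'.2.trans hb.2.symm)

omit [DecidableEq (PBond P j)] in
/-- Consistency with the no-go `T4WilsonGaugeFlatDirection`: for `d ≥ 2` a parity class contains no star
(`T4WilsonDisjointLinks.not_containsStar_of_plaqDisjoint`). [folklore] -/
theorem not_containsStar_dirClass (h2 : 2 ≤ P.d) (μ₀ : Fin P.d) (c : ZMod 2) (x₀ : Site P j) :
    ¬ ContainsStar (dirClass μ₀ c) x₀ :=
  not_containsStar_of_plaqDisjoint h2 (plaqDisjoint_dirClass μ₀ c) x₀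

omit [DecidableEq (PBond P j)] in
/-- Every link lies in the class of its own label. [folklore] -/
theorem mem_dirClass_linkLabel (b : PBond P j) : b ∈ dirClass b.dir (linkParity b) := mem_dirClass.2 ⟨rfl, rfl⟩

omit [DecidableEq (PBond P j)] in
/-- Distinct labels give disjoint classes. [folklore] -/
theorem disjoint_dirClass {q q' : Fin P.d × ZMod 2} (h : q ≠ q') :
    Disjoint (dirClass q.1 q.2 : Finset (PBond P j)) (dirClass q'.1 q'.2) :=
  Finset.disjoint_filter.2 fun _ _ h1 h2 => h (h1.symm.trans h2)

/-- **THE `2d` PARITY CLASSES COVER THE BOND SET** (as a `Finset.biUnion`, which wants decidable equality of bonds).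
[folklore] -/
theorem biUnion_dirClass :
    (Finset.univ : Finset (Fin P.d × ZMod 2)).biUnion (fun q => dirClass q.1 q.2)
      = (Finset.univ : Finset (PBond P j)) := by
  ext b
  simp only [Finset.mem_biUnion, Finset.mem_univ, true_and, iff_true]
  exact ⟨linkLabel b, mem_dirClass_linkLabel b⟩

omit [DecidableEq (PBond P j)] in
/-- **… AND PARTITION IT**: `Σ_{(μ₀, c)} #dirClass μ₀ c = #PBond`. [folklore] -/
theorem sum_card_dirClass :
    ∑ q : Fin P.d × ZMod 2, (dirClass q.1 q.2 : Finset (PBond P j)).card = Fintype.card (PBond P j) := by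
  rw [← Finset.card_univ, Finset.card_eq_sum_card_fiberwise (f := linkLabel) (s := Finset.univ)
    (t := (Finset.univ : Finset (Fin P.d × ZMod 2))) (fun b _ => Finset.mem_coe.2 (Finset.mem_univ _))]
  rfl

omit [DecidableEq (PBond P j)] in
/-- The links of one direction are as many as the sites. [folklore] -/
theorem card_filter_dir (μ₀ : Fin P.d) :
    (Finset.univ.filter fun b : PBond P j => b.dir = μ₀).card = Fintype.card (Site P j) := by
  rw [← Finset.card_univ (α := Site P j)]
  refine Finset.card_bij' (fun b _ => b.src) (fun x _ => (⟨x, μ₀⟩ : PBond P j)) (fun _ _ => Finset.mem_univ _)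
    (fun x _ => by simp) (fun b hb => ?_) (fun _ _ => rfl)
  obtain ⟨src, dir⟩ := b
  have h : dir = μ₀ := by simpa using hb
  subst h
  rfl

omit [DecidableEq (PBond P j)] in
/-- The unit step is injective on sites (`Site.unshift_shift` of `T4Covariance`). [folklore] -/
theorem shift_injective (ν : Fin P.d) : Function.Injective fun x : Site P j => x.shift ν := fun x y h => by
  have h' := congrArg (fun z : Site P j => z.unshift ν) h
  simpa only [Site.unshift_shift] using h'

/-- THE TRANSVERSE SHIFT of bonds, `⟨x, μ⟩ ↦ ⟨x + e_ν, μ⟩`, as an embedding. [folklore] -/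
def transShift (ν : Fin P.d) : PBond P j ↪ PBond P j :=
  ⟨fun b => ⟨b.src.shift ν, b.dir⟩, fun b b' h => by
    obtain ⟨src, dir⟩ := b
    obtain ⟨src', dir'⟩ := b'
    simp only [PBond.mk.injEq] at h
    obtain ⟨h1, h2⟩ := h
    rw [shift_injective ν h1, h2]⟩

omit [DecidableEq (PBond P j)] in
/-- `transShift ν b = ⟨b.src + e_ν, b.dir⟩`. [folklore] -/
@[simp] theorem transShift_apply (ν : Fin P.d) (b : PBond P j) : transShift ν b = ⟨b.src.shift ν, b.dir⟩ := rfl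

omit [DecidableEq (PBond P j)] in
/-- **THE TRANSVERSE SHIFT SWAPS THE TWO CLASSES OF A DIRECTION**: for `ν ≠ μ₀` it maps `dirClass μ₀ c` into
`dirClass μ₀ (c + 1)` (`tparity_shift_of_ne`). [folklore] -/
theorem map_transShift_subset {μ₀ ν : Fin P.d} (hν : ν ≠ μ₀) (c : ZMod 2) :
    (dirClass μ₀ c : Finset (PBond P j)).map (transShift ν) ⊆ dirClass μ₀ (c + 1) := by
  intro b hb
  rw [Finset.mem_map] at hb
  obtain ⟨a, ha, rfl⟩ := hb
  rw [mem_dirClass] at ha ⊢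
  have hν' : ν ≠ a.dir := fun h => hν (h.trans ha.1)
  refine ⟨ha.1, ?_⟩
  unfold linkParity at ha ⊢
  rw [transShift_apply]
  change tparity a.dir (a.src.shift ν) = c + 1
  rw [tparity_shift_of_ne hν', ha.2]

omit [DecidableEq (PBond P j)] in
/-- Hence (`d ≥ 2`: a transverse direction exists) the two classes of one direction are EQUINUMEROUS. [folklore] -/
theorem card_dirClass_succ (h2 : 2 ≤ P.d) (μ₀ : Fin P.d) (c : ZMod 2) :
    (dirClass μ₀ c : Finset (PBond P j)).card = (dirClass μ₀ (c + 1) : Finset (PBond P j)).card := by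
  haveI : Nontrivial (Fin P.d) := Fin.nontrivial_iff_two_le.2 h2
  obtain ⟨ν, hν⟩ := exists_ne μ₀
  have h11 : c + 1 + 1 = c := by
    have h : ∀ c : ZMod 2, c + 1 + 1 = c := by decide
    exact h c
  refine le_antisymm ?_ ?_
  · calc (dirClass μ₀ c : Finset (PBond P j)).card
          = ((dirClass μ₀ c : Finset (PBond P j)).map (transShift ν)).card := (Finset.card_map _).symm
      _ ≤ (dirClass μ₀ (c + 1) : Finset (PBond P j)).card := Finset.card_le_card (map_transShift_subset hν c)
  · calc (dirClass μ₀ (c + 1) : Finset (PBond P j)).card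
          = ((dirClass μ₀ (c + 1) : Finset (PBond P j)).map (transShift ν)).card := (Finset.card_map _).symm
      _ ≤ (dirClass μ₀ (c + 1 + 1) : Finset (PBond P j)).card :=
          Finset.card_le_card (map_transShift_subset hν (c + 1))
      _ = (dirClass μ₀ c : Finset (PBond P j)).card := by rw [h11]

/-- The links of direction `μ₀` are the union of the two parity classes `(μ₀, c)`, `(μ₀, c + 1)`. [folklore] -/
theorem filter_dir_eq_union (μ₀ : Fin P.d) (c : ZMod 2) :
    (Finset.univ.filter fun b : PBond P j => b.dir = μ₀) = dirClass μ₀ c ∪ dirClass μ₀ (c + 1) := by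
  have hz : ∀ z : ZMod 2, z = c ∨ z = c + 1 := by
    have h : ∀ c z : ZMod 2, z = c ∨ z = c + 1 := by decide
    exact h c
  ext b
  simp only [Finset.mem_filter, Finset.mem_univ, true_and, Finset.mem_union, mem_dirClass]
  constructor
  · intro h
    rcases hz (linkParity b) with h' | h'
    · exact Or.inl ⟨h, h'⟩
    · exact Or.inr ⟨h, h'⟩
  · rintro (⟨h, -⟩ | ⟨h, -⟩) <;> exact h

omit [DecidableEq (PBond P j)] in
/-- … and the two are disjoint. [folklore] -/
theorem disjoint_dirClass_succ (μ₀ : Fin P.d) (c : ZMod 2) :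
    Disjoint (dirClass μ₀ c : Finset (PBond P j)) (dirClass μ₀ (c + 1)) := by
  have h1 : c ≠ c + 1 := by
    have h : ∀ c : ZMod 2, c ≠ c + 1 := by decide
    exact h c
  exact Finset.disjoint_left.2 fun b hb hb' => h1 ((mem_dirClass.1 hb).2.symm.trans (mem_dirClass.1 hb').2)

omit [DecidableEq (PBond P j)] in
/-- **EACH PARITY CLASS HAS EXACTLY HALF OF THE SITES' WORTH OF LINKS** (`d ≥ 2`): `2 · #dirClass μ₀ c = #Site`, i.e.
the fraction `1/(2d)` of all `#PBond = d · #Site` links, uniformly in the torus. [folklore] -/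
theorem two_mul_card_dirClass (h2 : 2 ≤ P.d) (μ₀ : Fin P.d) (c : ZMod 2) :
    2 * (dirClass μ₀ c : Finset (PBond P j)).card = Fintype.card (Site P j) := by
  classical
  rw [← card_filter_dir μ₀, filter_dir_eq_union μ₀ c, Finset.card_union_of_disjoint (disjoint_dirClass_succ μ₀ c),
    ← card_dirClass_succ h2, two_mul]

omit [DecidableEq (PBond P j)] in
/-- In particular every parity class is non-empty (`d ≥ 2`). [folklore] -/
theorem dirClass_nonempty (h2 : 2 ≤ P.d) (μ₀ : Fin P.d) (c : ZMod 2) :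
    (dirClass μ₀ c : Finset (PBond P j)).Nonempty := by
  rw [← Finset.card_pos]
  have h := two_mul_card_dirClass (j := j) h2 μ₀ c
  have hS := card_site_pos P j
  omega

omit [DecidableEq (PBond P j)] in
/-- **THE CEILING IS ATTAINED FOR `d = 2`**: there each parity class has exactly a quarter of the links
(`4 · #dirClass μ₀ c = #PBond`), so it is a plaquette-disjoint link set of MAXIMUM size. [folklore] -/
theorem four_mul_card_dirClass (hd : P.d = 2) (μ₀ : Fin P.d) (c : ZMod 2) :
    4 * (dirClass μ₀ c : Finset (PBond P j)).card = Fintype.card (PBond P j) := by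
  have h := two_mul_card_dirClass (j := j) (le_of_eq hd.symm) μ₀ c
  rw [card_pbond, hd]
  omega

omit [DecidableEq (PBond P j)] in
/-- For general `d ≥ 2` the parity classes realise the fraction `2/d` of the ceiling: `2d · #dirClass μ₀ c = #PBond`
while `4 · #s ≤ #PBond` for every plaquette-disjoint `s`. [folklore] -/
theorem two_mul_d_mul_card_dirClass (h2 : 2 ≤ P.d) (μ₀ : Fin P.d) (c : ZMod 2) :
    2 * P.d * (dirClass μ₀ c : Finset (PBond P j)).card = Fintype.card (PBond P j) := by
  rw [card_pbond, ← two_mul_card_dirClass h2 μ₀ c]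
  ring

/-! ## §5  Maximality: every parity class is an inclusion-maximal plaquette-disjoint set (`d ≥ 2`) -/

omit [DecidableEq (PBond P j)] in
/-- **EVERY LINK OUTSIDE A PARITY CLASS IS A STAPLE BOND OF A LINK INSIDE IT** (`d ≥ 2`).  A link `⟨x, μ₀⟩` of the
other parity has the class member `⟨x + e_ν, μ₀⟩` (`ν ≠ μ₀`) opposite to it in `(x; μ₀, ν)` resp. `(x; ν, μ₀)`; a link
`⟨x, μ₁⟩`, `μ₁ ≠ μ₀`, lies on the plaquette `(x; μ₀, μ₁)` resp. `(x; μ₁, μ₀)` together with BOTH `⟨x, μ₀⟩` and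
`⟨x + e_{μ₁}, μ₀⟩`, whose parities are opposite, so one of them is in the class. [folklore] -/
theorem exists_isStaple_mem_dirClass (h2 : 2 ≤ P.d) (μ₀ : Fin P.d) (c : ZMod 2) {b : PBond P j}
    (hb : b ∉ dirClass μ₀ c) : ∃ b' ∈ dirClass μ₀ c, IsStaple b b' := by
  obtain ⟨x, μ₁⟩ := b
  have h11 : ∀ c : ZMod 2, c + 1 + 1 = c := by decide
  have hz : ∀ z c : ZMod 2, z ≠ c → z = c + 1 := by decide
  by_cases hμ : μ₁ = μ₀
  · subst hμ
    have hpar : tparity μ₁ x = c + 1 := hz _ _ fun h => hb (mem_dirClass.2 ⟨rfl, h⟩)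
    haveI : Nontrivial (Fin P.d) := Fin.nontrivial_iff_two_le.2 h2
    obtain ⟨ν, hν⟩ := exists_ne μ₁
    have hne : (⟨x.shift ν, μ₁⟩ : PBond P j) ≠ ⟨x, μ₁⟩ := fun h => shift_ne_self x ν (congrArg PBond.src h)
    refine ⟨⟨x.shift ν, μ₁⟩, mem_dirClass.2 ⟨rfl, ?_⟩, ?_⟩
    · change tparity μ₁ (x.shift ν) = c
      rw [tparity_shift_of_ne hν, hpar, h11]
    · rcases lt_or_gt_of_ne hν with hlt | hgt
      · -- `ν < μ₁`: `b = bond₄`, `b' = bond₂` of `(x; ν, μ₁)`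
        exact isStaple_of_isLetter (⟨x, ν, μ₁, hlt⟩ : Plaq P j) (Or.inr (Or.inr (Or.inr rfl))) (Or.inr (Or.inl rfl))
          hne
      · -- `μ₁ < ν`: `b = bond₁`, `b' = bond₃` of `(x; μ₁, ν)`
        exact isStaple_of_isLetter (⟨x, μ₁, ν, hgt⟩ : Plaq P j) (Or.inl rfl) (Or.inr (Or.inr (Or.inl rfl))) hne
  · have hne₁ : (⟨x, μ₀⟩ : PBond P j) ≠ ⟨x, μ₁⟩ := fun h => hμ (congrArg PBond.dir h).symm
    have hne₂ : (⟨x.shift μ₁, μ₀⟩ : PBond P j) ≠ ⟨x, μ₁⟩ := fun h => hμ (congrArg PBond.dir h).symm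
    have hshift : tparity μ₀ (x.shift μ₁) = tparity μ₀ x + 1 := tparity_shift_of_ne hμ x
    -- the two candidates and their letters on the common plaquette with `b`
    have hL : ∃ p : Plaq P j, IsLetter ⟨x, μ₁⟩ p ∧ IsLetter ⟨x, μ₀⟩ p ∧ IsLetter ⟨x.shift μ₁, μ₀⟩ p := by
      rcases lt_or_gt_of_ne hμ with hlt | hgt
      · -- `μ₁ < μ₀`: `p = (x; μ₁, μ₀)`, `b = bond₁`, `⟨x, μ₀⟩ = bond₄`, `⟨x + e_{μ₁}, μ₀⟩ = bond₂`
        exact ⟨⟨x, μ₁, μ₀, hlt⟩, Or.inl rfl, Or.inr (Or.inr (Or.inr rfl)), Or.inr (Or.inl rfl)⟩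
      · -- `μ₀ < μ₁`: `p = (x; μ₀, μ₁)`, `b = bond₄`, `⟨x, μ₀⟩ = bond₁`, `⟨x + e_{μ₁}, μ₀⟩ = bond₃`
        exact ⟨⟨x, μ₀, μ₁, hgt⟩, Or.inr (Or.inr (Or.inr rfl)), Or.inl rfl, Or.inr (Or.inr (Or.inl rfl))⟩
    obtain ⟨p, hbp, h₁p, h₂p⟩ := hL
    by_cases hq : tparity μ₀ x = c
    · exact ⟨⟨x, μ₀⟩, mem_dirClass.2 ⟨rfl, hq⟩, isStaple_of_isLetter p hbp h₁p hne₁⟩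
    · refine ⟨⟨x.shift μ₁, μ₀⟩, mem_dirClass.2 ⟨rfl, ?_⟩, isStaple_of_isLetter p hbp h₂p hne₂⟩
      change tparity μ₀ (x.shift μ₁) = c
      rw [hshift, hz _ _ hq, h11]

omit [DecidableEq (PBond P j)] in
/-- **MAXIMALITY** (`d ≥ 2`): a plaquette-disjoint link set containing a parity class IS that class — the disjoint
plug `T4WilsonDisjointLinks.mem_respDom_of_wilson_disjoint` applies to `dirClass μ₀ c` verbatim
(`hdis := plaqDisjoint_dirClass μ₀ c`) and to no larger fibre through it. [folklore] -/
theorem dirClass_maximal (h2 : 2 ≤ P.d) {μ₀ : Fin P.d} {c : ZMod 2} {s : Finset (PBond P j)} (hs : PlaqDisjoint s)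
    (hsub : dirClass μ₀ c ⊆ s) : s = dirClass μ₀ c := by
  refine Finset.Subset.antisymm (fun b hb => ?_) hsub
  by_contra hbc
  obtain ⟨b', hb', hst⟩ := exists_isStaple_mem_dirClass h2 μ₀ c hbc
  exact hs b hb b' hst (hsub hb')

/-- The union of the two classes of one direction is ALL of that direction, hence not plaquette-disjoint (`d ≥ 2`,
`not_plaqDisjoint_of_dir_subset`): the partition into `2d` classes cannot be coarsened within a direction. [folklore] -/
theorem not_plaqDisjoint_union_dirClass (h2 : 2 ≤ P.d) (μ₀ : Fin P.d) (c : ZMod 2) :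
    ¬ PlaqDisjoint (dirClass μ₀ c ∪ dirClass μ₀ (c + 1) : Finset (PBond P j)) := by
  refine not_plaqDisjoint_of_dir_subset h2 μ₀ fun x => ?_
  have hx : (⟨x, μ₀⟩ : PBond P j) ∈ Finset.univ.filter fun b : PBond P j => b.dir = μ₀ := by simp
  rwa [filter_dir_eq_union μ₀ c] at hx

/-- Numerical summary at `d = 4` (the dimension of the cell's target): every plaquette-disjoint link set has at most
`#Site` links (`= #PBond/4`), each of the eight parity classes has `#Site/2`, and a gauge-fixed fibre `univ \ T` with
`#T < #Site` has more than `3·#Site` links. [folklore] -/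
example (hd : P.d = 4) {s : Finset (PBond P j)} (hs : PlaqDisjoint s) : s.card ≤ Fintype.card (Site P j) := by
  have h := four_mul_card_le_card_pbond (by omega) hs
  rw [card_pbond, hd] at h
  omega

end Literature.MathematicalPhysics.QuantumFieldTheory.Balaban1983to89.T4PlaqDisjointFamilies

end
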